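import Summits.KontsevichZagierPeriods.KontsevichZagierPeriods.Theorems.FurushoPentagonDoubleShuffleInKZOhnoSeries
import Summits.KontsevichZagierPeriods.KontsevichZagierPeriods.Theorems.FurushoPentagonDoubleShuffleInKZReduction

/-!
# `DoubleShuffleInKZ` (stmt-KontsevichZagierPeriods-14665, route `FurushoPentagon`) ⟸ Ohno's relations, II:
# the stuffles `s ∗ 1ˡ` as a generating series, and `reg_ш` through `𝐄 · θ(·)` (IKZ (4.16)–(4.17))

Helper file (`--supports stmt-KontsevichZagierPeriods-14665`), continuing `…OhnoSeries.lean`.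
Inside `𝔥^ = ℚ⟨⟨x,y⟩⟩ = NCSeries Bool ℚ` (`false = x`, `true = y`), with `𝐄 = Σ y^m = IKZ.geom true 1`,
`θ : a ↦ a𝐄` (`IKZ.thetaSub`), `Δ` (`IKZ.deltaSub`) and the series
`F_s := 𝐄 · θ(Δ(w_s))` (`w_s = MZV.binaryWord s`), this file proves:

* `stuffleGen_apply` — **`F_s` is the generating series of the stuffles with `1ˡ`**: its
  coefficient on a word `v` of weight `|s| + l` is the multiplicity of `v` among the binary words
  of `s ∗ (1,…,1)` (`MZV.stuffle s (replicate l 1)`) — Hoffman's recursion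
  `(a s') ∗ (1 t') = a(s' ∗ 1t') + 1(as' ∗ t') + (a+1)(s' ∗ t')` is the series identity
  `F_{a s'} = x^{a-1} y F_{s'} + xᵃ y F_{s'} + y F_{a s'}` (`𝐄 = 1 + y𝐄`): the left-hand side
  `(1 - yu)^{-1} ∗ w` of [IharaKanekoZagier2006, (4.16)];
* `E_mul_thetaProd_apply` — `𝐄 · θ(u) = Σ_m y^m ш u` coefficientwise (insert `y`'s in all gaps);
  hence (`sum_reg_E_mul_theta`) `reg_ш` kills everything in `𝐄 · θ(φ)` but `φ` in top weight
  (`reg_ш` is a `ш`-homomorphism, `reg_ш(y^m) = 0`): the right-hand side `(1-yu)^{-1} ш Δ_u(w)`.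

References: K. Ihara, M. Kaneko, D. Zagier, Compositio Math. 142 (2006), Prop. 7, Cor. 3,
(4.16)–(4.17), Cor. 5; M. E. Hoffman, J. Algebra 194 (1997), §2.
-/

noncomputable section

open scoped BigOperators
open Literature.NumberTheory.Transcendental NCSeries IKZ

namespace Summit.KontsevichZagierPeriods.FurushoPentagon.DoubleShuffleInKZ

/-! ## 1. Inserting `y`'s in all gaps: `𝐄 · θ(u) = Σ_m y^m ш u` -/

/-- `count` through `map (cons c)`: only words starting with `c` occur. [folklore] -/
theorem count_cons_map_cons (b c : Bool) (w : List Bool) (L : List (List Bool)) :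
    (L.map (List.cons c)).count (b :: w) = if b = c then L.count w else 0 := by
  induction L with
  | nil => simp
  | cons v L ih =>
    rw [List.map_cons, List.count_cons, ih, List.count_cons]
    by_cases hb : b = c
    · subst hb; simp
    · rw [if_neg hb, if_neg hb, beq_eq_false_iff_ne.mpr (fun h => hb (List.cons.inj h).1.symm)]
      rfl

/-- **`𝐄 · θ(u) = Σ_m y^m ш u`**: the coefficient of `𝐄 · u₁𝐄 u₂𝐄 ⋯ u_k𝐄` on a word `w` is the
multiplicity of `w` in `y^{|w|-|u|} ш u` (insert `y`'s in all gaps of `u`).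
[cite: IharaKanekoZagier2006, Prop. 7 ((1-yu)⁻¹ ш w)] -/
theorem E_mul_thetaProd_apply : ∀ (w u : List Bool),
    (geom true 1 * (u.map thetaSub).prod : NCSeries Bool ℚ) w =
      ((MZV.shuffleWord (List.replicate (w.length - u.length) true) u).count w : ℚ)
  | [], u => by
    cases u with
    | nil => simp [mul_apply_nil']
    | cons a u =>
      rw [mul_apply_nil', List.map_cons, List.prod_cons, mul_apply_nil', thetaSub_apply_nil, zero_mul,
        mul_zero, List.length_nil, Nat.zero_sub, List.replicate_zero, MZV.shuffleWord_nil_left]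
      simp
  | b :: w, [] => by
    rw [List.map_nil, List.prod_nil, mul_one, geom_apply, List.length_nil, Nat.sub_zero,
      MZV.shuffleWord_nil_right, one_pow]
    by_cases h : b :: w = List.replicate (b :: w).length true
    · rw [if_pos h]; rw [← h]; simp
    · rw [if_neg h, List.count_eq_zero.mpr (fun hm => h (List.mem_singleton.mp hm)), Nat.cast_zero]
  | b :: w, a :: u => by
    -- the series recursion `𝐄 θ(a u) = a · 𝐄 θ(u) + y · 𝐄 θ(a u)`
    have hrec : (geom true 1 * ((a :: u).map thetaSub).prod : NCSeries Bool ℚ) =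
        letter a * (geom true 1 * (u.map thetaSub).prod) +
          letter true * (geom true 1 * ((a :: u).map thetaSub).prod) := by
      conv_lhs => rw [geom_eq_one_add true (1 : ℚ), one_smul]
      rw [List.map_cons, List.prod_cons, thetaSub, add_mul, one_mul]
      simp only [mul_assoc]
    rw [hrec, NCSeries.add_apply, letter_mul_apply_cons, letter_mul_apply_cons, E_mul_thetaProd_apply w u,
      E_mul_thetaProd_apply w (a :: u), List.length_cons, List.length_cons]
    -- the shuffle recursion
    rcases Nat.lt_or_ge w.length (u.length + 1) with hlt | hge
    · -- too short: no `y` can be inserted in front of `a u`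
      have hsu : w.length - (u.length + 1) = 0 := by omega
      rw [show w.length + 1 - (u.length + 1) = w.length - u.length by omega, hsu, List.replicate_zero,
        MZV.shuffleWord_nil_left]
      have h0 : ([a :: u].count w : ℚ) = 0 := by
        rw [List.count_eq_zero.mpr fun hm => ?_, Nat.cast_zero]
        rw [List.mem_singleton] at hm
        rw [hm] at hlt
        simp at hlt
      rw [h0]
      rcases Nat.lt_or_ge w.length u.length with hlt' | hge'
      · rw [show w.length - u.length = 0 by omega, List.replicate_zero, MZV.shuffleWord_nil_left,
          MZV.shuffleWord_nil_left]
        have h1 : ([u].count w : ℚ) = 0 := by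
          rw [List.count_eq_zero.mpr fun hm => ?_, Nat.cast_zero]
          rw [List.mem_singleton] at hm; rw [hm] at hlt'; exact lt_irrefl _ hlt'
        have h2 : ([a :: u].count (b :: w) : ℚ) = 0 := by
          rw [List.count_eq_zero.mpr fun hm => ?_, Nat.cast_zero]
          rw [List.mem_singleton] at hm; rw [(List.cons.inj hm).2] at hlt'; exact lt_irrefl _ hlt'
        rw [h1, h2]; split_ifs <;> simp
      · have hwu : w.length = u.length := by omega
        rw [hwu, Nat.sub_self, List.replicate_zero, MZV.shuffleWord_nil_left, MZV.shuffleWord_nil_left]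
        by_cases hb : b = a
        · subst hb; simp [List.count_cons]
        · rw [if_neg hb]; simp [Ne.symm hb]
    · rw [show w.length + 1 - (u.length + 1) = (w.length - (u.length + 1)) + 1 by omega, List.replicate_succ,
        MZV.shuffleWord_cons_cons, List.count_append, count_cons_map_cons, count_cons_map_cons,
        show w.length - u.length = w.length - (u.length + 1) + 1 by omega, List.replicate_succ, Nat.cast_add]
      simp only [Nat.cast_ite, Nat.cast_zero]
      abel

/-! ## 2. `reg_ш` through `𝐄 · θ(φ)`: only the top weight of `φ` survives -/

/-- Expansion of `ψ · φ(f)` along the monomials of `φ`: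
`c_w(ψ · φ(f)) = Σ_{|u| ≤ |w|} c_u(φ) c_w(ψ · f(u₁)⋯f(u_k))`. [folklore] -/
theorem mul_subst_apply {f : Bool → NCSeries Bool ℚ} (hf : ∀ a, f a [] = 0)
    (ψ φ : NCSeries Bool ℚ) (w : List Bool) :
    (ψ * subst f φ) w = ∑ u ∈ wordsLE Bool w.length, φ u * (ψ * (u.map f).prod) w := by
  rw [mul_apply]
  have h1 : ∀ p ∈ splits w, ψ p.1 * subst f φ p.2 =
      ∑ u ∈ wordsLE Bool w.length, φ u * (ψ p.1 * (u.map f).prod p.2) := by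
    intro p hp
    have hl := congrArg List.length (mem_splits.mp hp)
    rw [List.length_append] at hl
    rw [subst_apply, evalTrunc_apply, Finset.mul_sum]
    have hsub : wordsLE Bool p.2.length ⊆ wordsLE Bool w.length := fun u hu => by
      rw [mem_wordsLE] at hu ⊢; omega
    rw [← Finset.sum_subset hsub fun u _ hu => by
      rw [mem_wordsLE, not_le] at hu
      rw [prod_map_apply_eq_zero hf hu, mul_zero, mul_zero]]
    exact Finset.sum_congr rfl fun u _ => by ring
  rw [Finset.sum_congr rfl h1, Finset.sum_comm]
  refine Finset.sum_congr rfl fun u _ => ?_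
  rw [mul_apply, Finset.mul_sum]

/-- `reg_ш(y^{m}) = 0` for `m ≥ 1`, in the completed shuffle algebra.
[cite: IharaKanekoZagier2006, §3 p. 314] -/
theorem reg_replicate_true_succ (m : ℕ) : ShuffleAlgebra.reg (List.replicate (m + 1) true) = 0 := by
  refine ShuffleAlgebra.ext fun v => ?_
  rw [← ShuffleAlgebra.shuffleReg_apply, shuffleReg_replicate_true, ShuffleAlgebra.zero_apply,
    Finsupp.zero_apply]

/-- `reg_ш(∅) = 1`. [cite: IharaKanekoZagier2006, §3 p. 314] -/
theorem reg_nil : ShuffleAlgebra.reg ([] : List Bool) = 1 := by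
  refine ShuffleAlgebra.ext fun v => ?_
  rw [← ShuffleAlgebra.shuffleReg_apply, MZV.shuffleReg_of_isConvergentWord (Or.inl rfl),
    Finsupp.single_apply, ← ShuffleAlgebra.word_nil, ShuffleAlgebra.word_apply]
  by_cases h : v = []
  · subst h; simp
  · rw [if_neg h, if_neg (Ne.symm h)]

/-- `reg_ш` is the identity on convergent words: `reg(w) = w`.
[cite: IharaKanekoZagier2006, §3 p. 314 (reg_ш is the identity on 𝔥⁰)] -/
theorem reg_of_isConvergentWord {w : List Bool} (hw : MZV.IsConvergentWord w) :
    ShuffleAlgebra.reg w = ShuffleAlgebra.word w := by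
  refine ShuffleAlgebra.ext fun v => ?_
  rw [← ShuffleAlgebra.shuffleReg_apply, MZV.shuffleReg_of_isConvergentWord hw, Finsupp.single_apply,
    ShuffleAlgebra.word_apply]
  by_cases h : v = w
  · subst h; simp
  · rw [if_neg h, if_neg (Ne.symm h)]

/-- `Σ_{w ∈ L} g(w) = Σ_{|w| = n} (#occurrences of w in L) · g(w)` for a list of words of length
`n`. [folklore] -/
theorem list_sum_map_eq_sum_count_nsmul {M : Type*} [AddCommMonoid M] (n : ℕ) (g : List Bool → M) :
    ∀ L : List (List Bool), (∀ w ∈ L, w.length = n) →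
    (L.map g).sum = ∑ w ∈ wordsOfLength Bool n, L.count w • g w
  | [], _ => by simp
  | v :: L, hL => by
    rw [List.map_cons, List.sum_cons, list_sum_map_eq_sum_count_nsmul n g L (fun w hw => hL w (by simp [hw]))]
    have hv : v ∈ wordsOfLength Bool n := mem_wordsOfLength.mpr (hL v (by simp))
    simp only [List.count_cons, add_smul, Finset.sum_add_distrib]
    rw [add_comm]
    congr 1
    rw [Finset.sum_eq_single_of_mem v hv (fun w _ hne => by simp [Ne.symm hne])]
    simp

/-- `C(n) · f = n • f` in the completed shuffle algebra. [folklore] -/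
theorem shuffleAlgebra_C_natCast_mul (n : ℕ) (f : ShuffleAlgebra Bool ℚ) :
    ShuffleAlgebra.C (n : ℚ) * f = n • f := by
  refine ShuffleAlgebra.ext fun v => ?_
  rw [ShuffleAlgebra.C_mul_apply]
  induction n with
  | zero => simp
  | succ n ih => rw [succ_nsmul, ShuffleAlgebra.add_apply, ← ih]; push_cast; ring

/-- **`reg_ш` through `𝐄·θ`**: for every series `φ`, in weight `n`,
`Σ_{|w|=n} c_w(𝐄 θ(φ)) reg(w) = Σ_{|w|=n} c_w(φ) reg(w)` — `𝐄 θ(u) = Σ_m y^m ш u`, `reg_ш` is a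
`ш`-homomorphism and `reg_ш(y^m) = 0` (`m ≥ 1`). [cite: IharaKanekoZagier2006, Cor. 3 (4.17)] -/
theorem sum_reg_E_mul_theta (φ : NCSeries Bool ℚ) (n : ℕ) :
    ∑ w ∈ wordsOfLength Bool n,
        ShuffleAlgebra.C ((geom true 1 * subst thetaSub φ : NCSeries Bool ℚ) w) * ShuffleAlgebra.reg w =
      ∑ w ∈ wordsOfLength Bool n, ShuffleAlgebra.C (φ w) * ShuffleAlgebra.reg w := by
  -- expand along the monomials of `φ`
  have hexp : ∀ w ∈ wordsOfLength Bool n,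
      ShuffleAlgebra.C ((geom true 1 * subst thetaSub φ : NCSeries Bool ℚ) w) * ShuffleAlgebra.reg w =
      ∑ u ∈ wordsLE Bool n, ShuffleAlgebra.C (φ u) *
        (ShuffleAlgebra.C ((MZV.shuffleWord (List.replicate (n - u.length) true) u).count w : ℚ) *
          ShuffleAlgebra.reg w) := by
    intro w hw
    rw [mem_wordsOfLength] at hw
    rw [mul_subst_apply thetaSub_apply_nil, hw, ← ShuffleAlgebra.CHom_apply, map_sum, Finset.sum_mul]
    refine Finset.sum_congr rfl fun u _ => ?_
    rw [map_mul, ShuffleAlgebra.CHom_apply, ShuffleAlgebra.CHom_apply, E_mul_thetaProd_apply, hw, mul_assoc]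
  rw [Finset.sum_congr rfl hexp, Finset.sum_comm]
  -- for each `u`: `Σ_w #(w ∈ y^j ш u) reg w = reg(y^j) ш reg(u)`
  have hkey : ∀ u ∈ wordsLE Bool n,
      ∑ w ∈ wordsOfLength Bool n, ShuffleAlgebra.C (φ u) *
        (ShuffleAlgebra.C ((MZV.shuffleWord (List.replicate (n - u.length) true) u).count w : ℚ) *
          ShuffleAlgebra.reg w) = if u.length = n then ShuffleAlgebra.C (φ u) * ShuffleAlgebra.reg u else 0 := by
    intro u hu
    rw [mem_wordsLE] at hu
    rw [← Finset.mul_sum]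
    simp only [shuffleAlgebra_C_natCast_mul]
    rw [← list_sum_map_eq_sum_count_nsmul n ShuffleAlgebra.reg _ fun w hw => by
      rw [MZV.length_of_mem_shuffleWord _ _ hw, List.length_replicate]; omega, ShuffleAlgebra.reg_mul]
    split_ifs with h
    · rw [h, Nat.sub_self, List.replicate_zero, reg_nil, one_mul]
    · obtain ⟨m, hm⟩ : ∃ m, n - u.length = m + 1 := ⟨n - u.length - 1, by omega⟩
      rw [hm, reg_replicate_true_succ, zero_mul, mul_zero]
  rw [Finset.sum_congr rfl hkey, ← Finset.sum_filter]
  refine Finset.sum_congr ?_ fun _ _ => rfl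
  ext u
  simp only [Finset.mem_filter, mem_wordsLE, mem_wordsOfLength]
  omega

/-! ## 3. The stuffle generating series `F_s = 𝐄 · θ(Δ(w_s))` -/

/-- Binary words of `cons`ed indices: `binaryWord (a :: u) = x^{a-1} y ++ binaryWord u`. [folklore] -/
theorem map_binaryWord_map_cons (a : ℕ) (L : List (List ℕ)) :
    (L.map (List.cons a)).map MZV.binaryWord =
      (L.map MZV.binaryWord).map fun v => (List.replicate (a - 1) false ++ [true]) ++ v := by
  simp [List.map_map, Function.comp_def, MZV.binaryWord]

/-- `binaryWord (1,…,1) = y^l`. [folklore] -/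
theorem binaryWord_replicate_one : ∀ l : ℕ, MZV.binaryWord (List.replicate l 1) = List.replicate l true
  | 0 => rfl
  | l + 1 => by
    rw [List.replicate_succ, MZV.binaryWord, binaryWord_replicate_one l, List.replicate_succ]; rfl

/-- `count` through `map (p ++ ·)`: words with prefix `p`, shifted. [folklore] -/
theorem count_map_append (p w : List Bool) (L : List (List Bool)) :
    (L.map fun v => p ++ v).count w = if p <+: w then L.count (w.drop p.length) else 0 := by
  split_ifs with h
  · obtain ⟨t, rfl⟩ := h
    rw [List.drop_left, List.count_map_of_injective L (fun v => p ++ v) (List.append_right_injective p) t]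
  · exact List.count_eq_zero.mpr fun hw => by
      obtain ⟨v, -, rfl⟩ := List.mem_map.mp hw
      exact h (List.prefix_append p v)

/-- `[p <+: w][w.drop |p| = t] = [w = p t]`. [folklore] -/
theorem ite_prefix_drop_eq (p t w : List Bool) {n : ℕ} (hn : p.length = n) (c : ℚ) :
    (if p <+: w then (if w.drop n = t then c else 0) else 0) = if w = p ++ t then c else 0 := by
  subst hn
  by_cases hw : w = p ++ t
  · subst hw
    rw [if_pos (List.prefix_append p t), List.drop_left, if_pos rfl, if_pos rfl]
  · rw [if_neg hw]
    split_ifs with h1 h2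
    · obtain ⟨r, rfl⟩ := h1
      rw [List.drop_left] at h2
      exact absurd (by rw [h2]) hw
    · rfl
    · rfl

/-- **Hoffman's recursion as a series identity**: with `F_s = 𝐄·θ(Δ(w_s))`,
`F_{a s'} = x^{a-1} y F_{s'} + xᵃ y F_{s'} + y F_{a s'}` for `a ≥ 1`
(`(a s') ∗ (1 t) = a(s' ∗ 1 t) + (a+1)(s' ∗ t) + 1(a s' ∗ t)`). [cite: Hoffman1997, §2 (A3)] -/
theorem stuffleGen_cons {a : ℕ} (ha : 1 ≤ a) (s : List ℕ) :
    (geom true 1 * subst thetaSub (subst deltaSub (monomial (MZV.binaryWord (a :: s)) 1)) : NCSeries Bool ℚ) =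
      letter false ^ (a - 1) * letter true *
          (geom true 1 * subst thetaSub (subst deltaSub (monomial (MZV.binaryWord s) 1))) +
        letter false ^ a * letter true *
          (geom true 1 * subst thetaSub (subst deltaSub (monomial (MZV.binaryWord s) 1))) +
        letter true *
          (geom true 1 * subst thetaSub (subst deltaSub (monomial (MZV.binaryWord (a :: s)) 1))) := by
  obtain ⟨k, rfl⟩ : ∃ k, a = k + 1 := ⟨a - 1, by omega⟩
  rw [theta_delta_binaryWord, theta_delta_binaryWord, List.map_cons, List.prod_cons, Nat.add_sub_cancel]
  set P := ((s.map fun k => (letter false : NCSeries Bool ℚ) ^ (k - 1) *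
    ((1 + letter false) * (letter true * geom true 1))).prod)
  nth_rewrite 1 [geom_eq_one_add true (1 : ℚ)]
  rw [one_smul, pow_succ]
  noncomm_ring

/-- The stuffle generating series has no constant term for `s ≠ ∅`. [cite: Hoffman1997, §2] -/
theorem stuffleGen_apply_nil (a : ℕ) (s : List ℕ) :
    (geom true 1 * subst thetaSub (subst deltaSub (monomial (MZV.binaryWord (a :: s)) 1)) :
      NCSeries Bool ℚ) [] = 0 := by
  rw [mul_apply_nil', subst_apply_nil, MZV.binaryWord, subst_monomial_append deltaSub_apply_nil,
    subst_monomial_append deltaSub_apply_nil, mul_apply_nil', mul_apply_nil',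
    show (monomial [true] 1 : NCSeries Bool ℚ) = letter true from rfl, subst_letter deltaSub_apply_nil,
    deltaSub_apply_nil, mul_zero, zero_mul, mul_zero]

/-- The stuffle generating series vanishes below the weight of `s` and, in that weight, is `w_s`.
[cite: Hoffman1997, §2] -/
theorem stuffleGen_apply_of_le : ∀ (s : List ℕ), (∀ i ∈ s, 1 ≤ i) → ∀ w : List Bool,
    w.length ≤ MZV.weight s →
    (geom true 1 * subst thetaSub (subst deltaSub (monomial (MZV.binaryWord s) 1)) : NCSeries Bool ℚ) w =
      if w = MZV.binaryWord s then 1 else 0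
  | [], _, w, hw => by
    rw [MZV.weight_nil, Nat.le_zero, List.length_eq_zero_iff] at hw
    subst hw
    rw [MZV.binaryWord, monomial_nil_one, subst_one, subst_one, mul_one, geom_apply_nil, if_pos rfl]
  | a :: s, hs, w, hw => by
    have ha : 1 ≤ a := hs a (by simp)
    have hs' : ∀ i ∈ s, 1 ≤ i := fun i hi => hs i (by simp [hi])
    have hwt : MZV.weight (a :: s) = a + MZV.weight s := by simp [MZV.weight]
    induction w with
    | nil =>
      rw [stuffleGen_apply_nil, if_neg]
      simp [MZV.binaryWord]
    | cons b w ih =>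
      have hlen : w.length + 1 ≤ a + MZV.weight s := by rw [← hwt]; simpa using hw
      rw [stuffleGen_cons ha, NCSeries.add_apply, NCSeries.add_apply, pow_x_mul_y_mul_apply,
        pow_x_mul_y_mul_apply, letter_mul_apply_cons, Nat.sub_add_cancel ha,
        ih (by simp only [List.length_cons] at hw ⊢; omega),
        stuffleGen_apply_of_le s hs' ((b :: w).drop a) (by simp; omega),
        stuffleGen_apply_of_le s hs' ((b :: w).drop (a + 1)) (by simp; omega)]
      -- third term: lower weight, vanishes
      have h3 : (if b = true then (if w = MZV.binaryWord (a :: s) then (1 : ℚ) else 0) else 0) = 0 := by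
        have hne : w ≠ MZV.binaryWord (a :: s) := fun h => by
          have := congrArg List.length h
          rw [MZV.length_binaryWord hs, hwt] at this
          omega
        rw [if_neg hne, ite_self]
      -- second term: lower weight, vanishes
      have h2 : (if List.replicate a false ++ [true] <+: b :: w then
          (if (b :: w).drop (a + 1) = MZV.binaryWord s then (1 : ℚ) else 0) else 0) = 0 := by
        split_ifs with hp hne
        · exfalso
          have h1 := hp.length_le
          have h2 := congrArg List.length hne
          rw [MZV.length_binaryWord hs', List.length_drop, List.length_cons] at h2
          simp only [List.length_append, List.length_replicate, List.length_cons, List.length_nil] at h1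
          omega
        · rfl
        · rfl
      rw [h3, h2, add_zero, add_zero, ite_prefix_drop_eq _ _ _ (by simp; omega)]
      rfl

/-- **The stuffle generating series** (IKZ's `(1-yu)⁻¹ ∗ w_s`): for an index `s` with positive
entries, the coefficient of `F_s = 𝐄·θ(Δ(w_s))` on a word `w` of weight `|s| + l` is the multiplicity
of `w` among the binary words of the stuffles `s ∗ 1ˡ`. [cite: IharaKanekoZagier2006, (4.16)] -/
theorem stuffleGen_apply : ∀ (s : List ℕ), (∀ i ∈ s, 1 ≤ i) → ∀ (l : ℕ) (w : List Bool),
    w.length = MZV.weight s + l →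
    (geom true 1 * subst thetaSub (subst deltaSub (monomial (MZV.binaryWord s) 1)) : NCSeries Bool ℚ) w =
      (((MZV.stuffle s (List.replicate l 1)).map MZV.binaryWord).count w : ℚ)
  | [], _, l, w, hw => by
    rw [MZV.binaryWord, monomial_nil_one, subst_one, subst_one, mul_one, geom_apply, MZV.stuffle_nil_left,
      List.map_singleton, binaryWord_replicate_one, one_pow, MZV.weight_nil, zero_add] at *
    rw [hw]
    by_cases h : w = List.replicate l true
    · rw [if_pos h]; rw [h]; simp
    · rw [if_neg h, List.count_eq_zero.mpr (fun hm => h (List.mem_singleton.mp hm)), Nat.cast_zero]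
  | a :: s, hs, l, w, hw => by
    have ha : 1 ≤ a := hs a (by simp)
    have hs' : ∀ i ∈ s, 1 ≤ i := fun i hi => hs i (by simp [hi])
    have hwt : MZV.weight (a :: s) = a + MZV.weight s := by simp [MZV.weight]
    induction l generalizing w with
    | zero =>
      rw [stuffleGen_apply_of_le (a :: s) hs w (by omega), List.replicate_zero, MZV.stuffle_nil_right,
        List.map_singleton]
      by_cases h : w = MZV.binaryWord (a :: s)
      · rw [if_pos h]; rw [h]; simp
      · rw [if_neg h, List.count_eq_zero.mpr (fun hm => h (List.mem_singleton.mp hm)), Nat.cast_zero]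
    | succ l ihl =>
      cases w with
      | nil => simp [hwt] at hw
      | cons b w =>
        have hlen : w.length + 1 = a + MZV.weight s + (l + 1) := by rw [← hwt]; simpa using hw
        rw [stuffleGen_cons ha, NCSeries.add_apply, NCSeries.add_apply, pow_x_mul_y_mul_apply,
          pow_x_mul_y_mul_apply, letter_mul_apply_cons, Nat.sub_add_cancel ha,
          ihl w (by simp only [List.length_cons] at hw ⊢; omega),
          stuffleGen_apply s hs' (l + 1) ((b :: w).drop a) (by simp; omega),
          stuffleGen_apply s hs' l ((b :: w).drop (a + 1)) (by simp; omega)]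
        -- the stuffle side
        rw [List.replicate_succ, MZV.stuffle_cons_cons, ← List.replicate_succ, List.map_append,
          List.map_append, List.count_append, List.count_append, map_binaryWord_map_cons,
          map_binaryWord_map_cons, map_binaryWord_map_cons, count_map_append, count_map_append,
          count_map_append, Nat.cast_add, Nat.cast_add]
        simp only [List.length_append, List.length_replicate, List.length_singleton, Nat.sub_add_cancel ha,
          Nat.sub_self, List.replicate_zero, List.nil_append, Nat.add_sub_cancel]
        -- match the three terms
        have e1 : ∀ (P : Prop) [Decidable P] (m : ℕ), ((if P then m else 0 : ℕ) : ℚ) = if P then (m : ℚ) else 0 :=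
          fun P _ m => by split_ifs <;> simp
        rw [e1, e1, e1]
        have hB : (if [true] <+: b :: w then
            (((MZV.stuffle (a :: s) (List.replicate l 1)).map MZV.binaryWord).count ((b :: w).drop 1) : ℚ)
            else 0) = if b = true then
            (((MZV.stuffle (a :: s) (List.replicate l 1)).map MZV.binaryWord).count w : ℚ) else 0 := by
          by_cases hb : b = true
          · subst hb; simp
          · rw [if_neg hb, if_neg (by simp [hb])]
        rw [hB]
        ring

end Summit.KontsevichZagierPeriods.FurushoPentagon.DoubleShuffleInKZ
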